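import Literature.NumberTheory.Sieve.MatomakiRadziwillTheorem1ExpSum
import Literature.NumberTheory.LFunctions.VinogradovMeanValueTheorem
import Literature.NumberTheory.LFunctions.VinogradovZetaSum
import HarnessLib

/-!
# Matomäki–Radziwiłł, Theorem 1 — discharged

Topic `Literature/NumberTheory/Sieve`.  This file proves the named fact
`Literature.NumberTheory.Sieve.MatomakiRadziwill2016_theorem1` (`MatomakiRadziwill.lean`):

> **Theorem 1** (K. Matomäki, M. Radziwiłł, *Multiplicative functions in short intervals*, Ann. of
> Math. 183 (2016), 1015–1056, Theorem 1, p. 1016).  Let `f : ℕ → [-1, 1]` be multiplicative.  There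
> are absolute constants `C, C' > 1` such that for `2 ≤ h ≤ X` and `δ > 0`,
> `|h⁻¹ ∑_{x ≤ n ≤ x+h} f(n) − X⁻¹ ∑_{X ≤ n ≤ 2X} f(n)| ≤ δ + C' log log h / log h`
> for all but at most `C X ((log h)^{1/3}/(δ² h^{δ/25}) + 1/(δ² (log X)^{1/50}))` integers `x ∈ [X, 2X]`.

unconditionally: `MatomakiRadziwill2016_theorem1_holds`.  The whole deduction is in the tree —
Theorem 1 from Theorem 3 (`MatomakiRadziwillTheorem1.lean`), Theorem 3 from Lemma 14, Lemma 4 and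
Proposition 1, Proposition 1 from Lemmas 3 and 11 (Halász–Granville–Soundararajan and the twisted
prime number theorem in short intervals), the latter two from a Vinogradov–Korobov zero-free region
(`MatomakiRadziwillTheorem3VK.lean`), the region from Vinogradov's estimate for the zeta sums
`∑ (n+u)^{-it}` (`RichertBoundsFromExpSum.lean`, `ExpSumBoundReduction.lean`,
`MatomakiRadziwillTheorem1ExpSum.lean`: `MatomakiRadziwill2016_theorem1_of_vinogradovRange`), that
estimate from Vinogradov's mean value theorem by Ivić's Theorem 6.2
(`VinogradovZetaSum.vinogradovRangeBound_of_vmvtBound`), and the mean value theorem itself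
(`vmvtBound_thirtyTwo : VMVTBound 32`, Ivić's Lemmas 6.1–6.3, `VinogradovMeanValue*.lean`).
This file only composes the last three.

It also discharges the paper's main proposition, the named fact
`Literature.NumberTheory.Sieve.MatomakiRadziwill2016_prop1` (`MatomakiRadziwill.lean`):

> **Proposition 1** (loc. cit., §8 "The main proposition").  Let `f : ℕ → [-1,1]` be multiplicative, `𝒮`
> as in Section 2, `F(s) = ∑_{X ≤ n ≤ 2X, n ∈ 𝒮} f(n) n^{-s}`.  Then, for any `T`,
> `∫_{(log X)^{1/15}}^{T} |F(1+it)|² dt ≪ (T/(X/Q_1) + 1) ((log Q_1)^{1/3}/P_1^{1/6-η} + (log X)^{-1/50})`.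

unconditionally: `MatomakiRadziwill2016_prop1_holds`, composing the tree's proof of §8
(`MatomakiRadziwill2016_prop1_of_vk`, `MatomakiRadziwillLemma3VK.lean`: Proposition 1 from Lemmas 3, 7, 9,
11, 12, 13, with Lemmas 3 and 11 from a Vinogradov–Korobov zero-free region) with the same unconditional
region (`VinogradovZetaSum.hasVKZeroFreeRegion_of_vmvtBound` applied to `vmvtBound_thirtyTwo`).

## References
* K. Matomäki, M. Radziwiłł, *Multiplicative functions in short intervals*, Ann. of Math. (2) 183
  (2016), no. 3, 1015–1056, Theorem 1. doi:10.4007/annals.2016.183.3.6, arXiv:1501.04585.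
  [cite: MatomakiRadziwillAnnals2016, Theorem 1] [cite: MatomakiRadziwillAnnals2016, Proposition 1]
* A. Ivić, *The Riemann Zeta-Function* (Wiley 1985), Lemma 6.3 and Theorem 6.2. [cite: Ivic1985, Theorem 6.2]
-/

noncomputable section

namespace Literature.NumberTheory.Sieve

open Literature.NumberTheory.LFunctions

/-- **Matomäki–Radziwiłł 2016, Theorem 1, proved**: the named fact
`MatomakiRadziwill2016_theorem1` holds.  Proof: Vinogradov's mean value theorem (`VMVTBound 32`,
`vmvtBound_thirtyTwo`) gives Vinogradov's zeta-sum estimate in its natural range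
(`VinogradovZetaSum.vinogradovRangeBound_of_vmvtBound`: `VinogradovRangeBound 10 C c`), which feeds
the tree's conditional deduction `MatomakiRadziwill2016_theorem1_of_vinogradovRange`
(Vinogradov–Korobov region ⟹ Lemmas 3, 11 ⟹ Proposition 1 ⟹ Theorem 3 ⟹ Theorem 1).
[cite: MatomakiRadziwillAnnals2016, Theorem 1] -/
theorem MatomakiRadziwill2016_theorem1_holds : MatomakiRadziwill2016_theorem1 := by
  obtain ⟨C, c, hC, hc, h⟩ :=
    VinogradovZetaSum.vinogradovRangeBound_of_vmvtBound (A := 32) (by norm_num) vmvtBound_thirtyTwo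
  exact MatomakiRadziwill2016_theorem1_of_vinogradovRange (K := 10) (by norm_num) hC hc h

/-- **Matomäki–Radziwiłł 2016, Proposition 1, proved**: the named fact
`MatomakiRadziwill2016_prop1` holds — for every `η ∈ (0, 1/6)` there are `C, X₀` such that for all
`X ≥ X₀`, every system of sieve intervals `𝒮_X` with parameter `η`, every real multiplicative
`f : ℕ → [-1, 1]` and every `T ≥ (log X)^{1/15}`,
`∫_{(log X)^{1/15}}^{T} |F(1+it)|² dt ≤ C (T/(X/Q_1) + 1) ((log Q_1)^{1/3}/P_1^{1/6-η} + (log X)^{-1/50})`,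
`F(s) = ∑_{X ≤ n ≤ 2X, n ∈ 𝒮} f(n) n^{-s}`.  Proof: the paper's §8 argument as proved in the tree
(`MatomakiRadziwill2016_prop1_of_lemma3_lemma11`, `MatomakiRadziwillProp1*.lean`), with Lemma 3
(Halász–Granville–Soundararajan plus Lemma 2) and Lemma 11 (Halász for primes in short intervals) from a
Vinogradov–Korobov zero-free region (`MatomakiRadziwill2016_prop1_of_vk`, `MatomakiRadziwillLemma3VK.lean`),
and that region from Vinogradov's mean value theorem (`vmvtBound_thirtyTwo`) through Ivić's Theorem 6.2
(`VinogradovZetaSum.hasVKZeroFreeRegion_of_vmvtBound`).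
[cite: MatomakiRadziwillAnnals2016, Proposition 1 (§8 "The main proposition")] -/
theorem MatomakiRadziwill2016_prop1_holds : MatomakiRadziwill2016_prop1 := by
  obtain ⟨c, hc, hVK⟩ :=
    VinogradovZetaSum.hasVKZeroFreeRegion_of_vmvtBound (A := 32) (by norm_num) vmvtBound_thirtyTwo
  exact MatomakiRadziwill2016_prop1_of_vk hc hVK

end Literature.NumberTheory.Sieve
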